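import Summits.ResolutionOfSingularities.ResolutionOfSingularities.Theorems.WeightedInvariantIota3DropCurveFracStrict
import Summits.ResolutionOfSingularities.ResolutionOfSingularities.Theorems.WeightedInvariantP3aTieFreeDegenerate
import Summits.ResolutionOfSingularities.ResolutionOfSingularities.Theorems.WeightedInvariantHypersurfaceLocalGameEFTDimTwoNewton
import Summits.ResolutionOfSingularities.ResolutionOfSingularities.Theorems.WeightedInvariantWeightedFiltrationComparison
import Summits.ResolutionOfSingularities.ResolutionOfSingularities.Theorems.WeightedInvariantRegularSubschemeCentre
import Summits.ResolutionOfSingularities.ResolutionOfSingularities.Theorems.AQSHeightTwoWeightedContactUnique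
import HarnessLib

/-!
# The tie locus at a FRACTIONAL-SLOPE curve centre is the single curve `Y = 0`: the tie forces `λ ∈ 𝔪`, the `X = 0` locus is empty
# (door `HypersurfaceCentreConstruction`, stmt-ResolutionOfSingularities-19897; residual (D-b³-curve-FRAC-TIE-POINT) of `stub_keyRungGrHomLE_three`)

Topic: `Summits/ResolutionOfSingularities/ResolutionOfSingularities/Theorems`. Helper for the door item `HypersurfaceCentreConstruction`
(stmt-ResolutionOfSingularities-19897, route `WeightedInvariant`), line `local-engine`, def-free, `S`-side commutative algebra.  CURVE-TIE.md §3 (b):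
at a fractional-slope curve centre the AQS-adapted presentation has `f = c·y^ν + h`, `c` a unit, `h ∈ 𝒥_{bν+1}((y,x);(b,1))` (hand -8's
`Iota3.mem_span_pow_sup_of_curve_lexMax_frac`).  THIS FILE shows that such an `f`
* lies in NO steep tie ideal `𝒥_{(b+1)ν}((x, y − λx^b, z); (1, b+1, 1))` with `λ` a UNIT (**`Iota3.mem_maximalIdeal_of_mem_tie_of_normalForm`**:
  a tie forces `λ ∈ 𝔪`), and
* (for `b = 1`) does NOT lie in `𝒥_{2ν}((y, x, z); (1, 2, 1))` (**`Iota3.not_mem_weightedMonomialIdeal_X_of_normalForm`**: the `X = 0` locus of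
  …P3aTieLocus is empty),
both by weighted quasi-regularity of a regular system of parameters (`weightedQuasiRegular_of_linearIndependent_toCotangent`, Literature):
`c λ^ν x^{bν}` resp. `c y^ν` would be a unit monomial inside the next weighted piece.  Tools: the comparison of weighted filtrations
`weightedMonomialIdeal_pair_le_steep` (`𝒥ₙ((y,x);(b,1)) ≤ 𝒥ₙ((x, y−λx^b, z);(1,b+1,1))`), `weightedMonomialIdeal_steep_eq_of_mem_maximalIdeal`
(the steep filtration does not depend on `λ` modulo `𝔪`), `weightedMonomialIdeal_pair_le_pow` (`𝒥_{bν+1}((y,x);(b,1)) ≤ 𝔪^{ν+1}`),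
`exists_normalForm_of_mem_sup` (unit cofactor), `mem_maximalIdeal_of_monomial_mem` (a monomial with coefficient `c` in the next piece has `c ∈ 𝔪`).
So at a fractional-slope curve centre the residual (D-b³-curve-FRAC-TIE-POINT) concerns ONE successor: `(t⁻¹, z, y t^b)`, with
`f ∈ 𝒥_{(b+1)ν}((x, y, z); (1, b+1, 1))`.
[OURS · L1 W4.3 · (D-b³-curve-FRAC-TIE) (i)]  Replaces the role of NO printed item; NOT a statement of the manuscript under review
[claim: Hironaka2017, status: under-review]; candidates stay candidates; AI work, weaker than expert review.  No definition; no axiom.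

## References

* H. Matsumura, *Commutative Ring Theory* (1986), Thm. 16.2 (quasi-regularity of regular sequences). [Matsumura1987]
* D. Abramovich, M. H. Quek, B. Schober, arXiv:2507.01232 (v3, 2026), Thm 3.5. [AbramovichQuekSchober2025]
-/

noncomputable section

open IsLocalRing Literature.AlgebraicGeometry.Resolution
open Summit.ResolutionOfSingularities.ResolutionOfSingularities.Theorems

set_option linter.dupNamespace false -- mandated namespace of this single-conjunct summit

namespace Summit.ResolutionOfSingularities.ResolutionOfSingularities.Cruxes.HypersurfaceCentreConstruction.LocalEngine

namespace Iota3

section Filtrations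

variable {S : Type} [CommRing S]

/-- `𝒥ₙ((y, x); (b, 1)) ≤ 𝒥ₙ((x, y − λx^b, z); (1, b+1, 1))`: `y = (y − λx^b) + λx^b` has steep weight `≥ b`, `x` has weight `1`. [folklore] -/
theorem weightedMonomialIdeal_pair_le_steep (y x z lam : S) (b n : ℕ) :
    weightedMonomialIdeal ![y, x] ![b, 1] n ≤ weightedMonomialIdeal ![x, y - lam * x ^ b, z] ![1, b + 1, 1] n := by
  refine weightedMonomialIdeal_le_of_forall_mem_of_mul_le (weightedMonomialIdeal ![x, y - lam * x ^ b, z] ![1, b + 1, 1])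
    (weightedMonomialIdeal_zero _ _) (weightedMonomialIdeal_mul_le _ _) (weightedMonomialIdeal_antitone _ _) ![y, x] ![b, 1]
    (fun i => ?_) n
  have hx : x ∈ weightedMonomialIdeal ![x, y - lam * x ^ b, z] ![1, b + 1, 1] 1 :=
    Ideal.subset_span ⟨![1, 0, 0], by simp [Fin.sum_univ_three], by simp [Fin.prod_univ_three]⟩
  fin_cases i
  · change y ∈ weightedMonomialIdeal ![x, y - lam * x ^ b, z] ![1, b + 1, 1] b
    have hy' : y - lam * x ^ b ∈ weightedMonomialIdeal ![x, y - lam * x ^ b, z] ![1, b + 1, 1] b :=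
      weightedMonomialIdeal_antitone _ _ (Nat.le_succ b) (Ideal.subset_span ⟨![0, 1, 0], by simp [Fin.sum_univ_three], by simp [Fin.prod_univ_three]⟩)
    have hxb : lam * x ^ b ∈ weightedMonomialIdeal ![x, y - lam * x ^ b, z] ![1, b + 1, 1] b := by
      refine Ideal.mul_mem_left _ _ ?_
      have h := AQSHeightTwo.pow_mem_weightedMonomialIdeal_mul _ _ hx b
      rwa [one_mul] at h
    have h := Ideal.add_mem _ hy' hxb
    rwa [sub_add_cancel] at h
  · exact hx

/-- The steep filtration `𝒥((x, y − λx^b, z); (1, b+1, 1))` only depends on `λ` modulo `𝔪 = (x, y, z)` (`b ≥ 1`): one inclusion.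
[folklore] -/
theorem weightedMonomialIdeal_steep_le_of_sub_mem [IsLocalRing S] {y x z : S} (hxyz : Ideal.span {x, y, z} = maximalIdeal S)
    {b : ℕ} (hb : 1 ≤ b) {lam lam' : S} (h : lam - lam' ∈ maximalIdeal S) (n : ℕ) :
    weightedMonomialIdeal ![x, y - lam * x ^ b, z] ![1, b + 1, 1] n ≤
      weightedMonomialIdeal ![x, y - lam' * x ^ b, z] ![1, b + 1, 1] n := by
  refine weightedMonomialIdeal_le_of_forall_mem_of_mul_le (weightedMonomialIdeal ![x, y - lam' * x ^ b, z] ![1, b + 1, 1])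
    (weightedMonomialIdeal_zero _ _) (weightedMonomialIdeal_mul_le _ _) (weightedMonomialIdeal_antitone _ _) _ ![1, b + 1, 1]
    (fun i => ?_) n
  have hx : x ∈ weightedMonomialIdeal ![x, y - lam' * x ^ b, z] ![1, b + 1, 1] 1 :=
    Ideal.subset_span ⟨![1, 0, 0], by simp [Fin.sum_univ_three], by simp [Fin.prod_univ_three]⟩
  have hz : z ∈ weightedMonomialIdeal ![x, y - lam' * x ^ b, z] ![1, b + 1, 1] 1 :=
    Ideal.subset_span ⟨![0, 0, 1], by simp [Fin.sum_univ_three], by simp [Fin.prod_univ_three]⟩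
  have hy' : y - lam' * x ^ b ∈ weightedMonomialIdeal ![x, y - lam' * x ^ b, z] ![1, b + 1, 1] (b + 1) :=
    Ideal.subset_span ⟨![0, 1, 0], by simp [Fin.sum_univ_three], by simp [Fin.prod_univ_three]⟩
  fin_cases i
  · exact hx
  · change y - lam * x ^ b ∈ weightedMonomialIdeal ![x, y - lam' * x ^ b, z] ![1, b + 1, 1] (b + 1)
    -- `𝔪 ≤ 𝒥₁`, so `(lam - lam') x^b ∈ 𝒥₁ · 𝒥_b ≤ 𝒥_{b+1}`
    have hxb : x ^ b ∈ weightedMonomialIdeal ![x, y - lam' * x ^ b, z] ![1, b + 1, 1] b := by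
      have hpow := AQSHeightTwo.pow_mem_weightedMonomialIdeal_mul _ _ hx b
      rwa [one_mul] at hpow
    have hy1 : y ∈ weightedMonomialIdeal ![x, y - lam' * x ^ b, z] ![1, b + 1, 1] 1 := by
      have h := Ideal.add_mem _ (weightedMonomialIdeal_antitone _ _ (by omega : 1 ≤ b + 1) hy')
        (Ideal.mul_mem_left _ lam' (weightedMonomialIdeal_antitone _ _ hb hxb))
      rwa [sub_add_cancel] at h
    have h𝔪 : maximalIdeal S ≤ weightedMonomialIdeal ![x, y - lam' * x ^ b, z] ![1, b + 1, 1] 1 := by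
      rw [← hxyz, Ideal.span_le, Set.insert_subset_iff, Set.insert_subset_iff, Set.singleton_subset_iff]
      exact ⟨hx, hy1, hz⟩
    have hdiff : (lam - lam') * x ^ b ∈ weightedMonomialIdeal ![x, y - lam' * x ^ b, z] ![1, b + 1, 1] (b + 1) := by
      have h1b := weightedMonomialIdeal_mul_le _ _ _ _ (Ideal.mul_mem_mul (h𝔪 h) hxb)
      rwa [Nat.add_comm 1 b] at h1b
    have hres := Ideal.sub_mem _ hy' hdiff
    have heq : (y - lam' * x ^ b) - (lam - lam') * x ^ b = y - lam * x ^ b := by ring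
    rwa [heq] at hres
  · exact weightedMonomialIdeal_antitone _ _ (by omega : 1 ≤ 1) hz

/-- **The steep filtration does not see `λ` modulo `𝔪`**: for `λ ∈ 𝔪 = (x, y, z)` and `b ≥ 1`,
`𝒥ₙ((x, y − λx^b, z); (1, b+1, 1)) = 𝒥ₙ((x, y, z); (1, b+1, 1))`. [folklore] -/
theorem weightedMonomialIdeal_steep_eq_of_mem_maximalIdeal [IsLocalRing S] {y x z : S} (hxyz : Ideal.span {x, y, z} = maximalIdeal S)
    {b : ℕ} (hb : 1 ≤ b) {lam : S} (hlam : lam ∈ maximalIdeal S) (n : ℕ) :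
    weightedMonomialIdeal ![x, y - lam * x ^ b, z] ![1, b + 1, 1] n = weightedMonomialIdeal ![x, y, z] ![1, b + 1, 1] n := by
  have h0 : weightedMonomialIdeal ![x, y, z] ![1, b + 1, 1] n = weightedMonomialIdeal ![x, y - 0 * x ^ b, z] ![1, b + 1, 1] n := by
    rw [zero_mul, sub_zero]
  apply le_antisymm
  · rw [h0]
    exact weightedMonomialIdeal_steep_le_of_sub_mem hxyz hb (by rw [sub_zero]; exact hlam) n
  · rw [h0]
    exact weightedMonomialIdeal_steep_le_of_sub_mem hxyz hb (by rw [zero_sub]; exact neg_mem hlam) n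

/-- `𝒥_{bν+1}((y, x); (b, 1)) ≤ 𝔪^{ν+1}` (`b ≥ 1`): a monomial `y^j x^i` with `b j + i ≥ b ν + 1` has degree `j + i ≥ ν + 1`. [folklore] -/
theorem weightedMonomialIdeal_pair_le_pow [IsLocalRing S] {y x z : S} (hyxz : Ideal.span (Set.range ![y, x, z]) = maximalIdeal S)
    {b : ℕ} (hb : 1 ≤ b) (ν : ℕ) : weightedMonomialIdeal ![y, x] ![b, 1] (b * ν + 1) ≤ maximalIdeal S ^ (ν + 1) := by
  rw [weightedMonomialIdeal, Ideal.span_le]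
  rintro _ ⟨α, hα, rfl⟩
  have hdeg : ν + 1 ≤ ∑ i, α i := by
    simp only [Fin.sum_univ_two, Matrix.cons_val_zero, Matrix.cons_val_one] at hα ⊢
    by_contra hlt
    have h1 : b * α 0 + 1 * α 1 ≤ b * (α 0 + α 1) := by nlinarith
    have h2 : b * (α 0 + α 1) ≤ b * ν := Nat.mul_le_mul_left b (by omega)
    omega
  exact Ideal.pow_le_pow_right hdeg (LocalGameEFTCylinder.prod_pow_mem_pow_pair hyxz α)

end Filtrations

section NormalForm

variable {S : Type} [CommRing S] [IsRegularLocalRing S] {y x z : S}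

/-- **Unit monomials do not hide in the next piece**: for a regular system of parameters `u` (`(u) = 𝔪`, `dim S = d`) and positive weights, if
`c · uᵢ^e ∈ 𝒥_{wᵢ e + 1}(u; w)` then `c ∈ 𝔪` (weighted quasi-regularity). [cite: Matsumura1987, Thm. 16.2] -/
theorem mem_maximalIdeal_of_monomial_mem {d : ℕ} (u : Fin d → S) (hu : Ideal.span (Set.range u) = maximalIdeal S)
    (hdim : ringKrullDim S = d) (w : Fin d → ℕ) (hw : ∀ i, 0 < w i) (i : Fin d) (e : ℕ) {c : S}
    (hc : c * u i ^ e ∈ weightedMonomialIdeal u w (w i * e + 1)) : c ∈ maximalIdeal S := by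
  classical
  have hmem : ∀ j, u j ∈ maximalIdeal S := LocalGameEFTNewton.mem_maximalIdeal_of_span_eq u hu
  have hli := linearIndependent_toCotangent_of_span_eq_maximalIdeal hdim u hu
  have hP : (MvPolynomial.monomial (Finsupp.single i e) c).IsWeightedHomogeneous w (w i * e) :=
    MvPolynomial.isWeightedHomogeneous_monomial w _ c (by
      rw [Finsupp.weight_apply, Finsupp.sum_single_index (by simp)]; simp [mul_comm])
  have heval : MvPolynomial.eval u (MvPolynomial.monomial (Finsupp.single i e) c) ∈ (weightedFiltration u w).ideal (w i * e + 1) := by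
    rw [← weightedMonomialIdeal_eq_weightedFiltration_ideal, MvPolynomial.eval_monomial]
    simpa [Finsupp.prod_single_index] using hc
  have h := weightedQuasiRegular_of_linearIndependent_toCotangent u w hw hmem hli _ _ hP heval (Finsupp.single i e)
  rw [MvPolynomial.coeff_monomial, if_pos rfl, hu] at h
  exact h

/-- **Normal form with a unit cofactor.**  `f ∈ (y^ν) + 𝒥_{bν+1}((y,x);(b,1))`, `f ∉ 𝔪^{ν+1}`, `b ≥ 1` ⟹ `f = c y^ν + h` with `c` a UNIT and
`h ∈ 𝒥_{bν+1}((y,x);(b,1))`. [folklore] -/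
theorem exists_normalForm_of_mem_sup (hyxz : Ideal.span (Set.range ![y, x, z]) = maximalIdeal S) {b ν : ℕ} (hb : 1 ≤ b) {f : S}
    (hf : f ∈ Ideal.span {y ^ ν} ⊔ weightedMonomialIdeal ![y, x] ![b, 1] (b * ν + 1)) (hfν : f ∉ maximalIdeal S ^ (ν + 1)) :
    ∃ c h : S, IsUnit c ∧ h ∈ weightedMonomialIdeal ![y, x] ![b, 1] (b * ν + 1) ∧ f = c * y ^ ν + h := by
  obtain ⟨a, ha, h, hh, hah⟩ := Submodule.mem_sup.mp hf
  obtain ⟨c, rfl⟩ := Ideal.mem_span_singleton'.mp ha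
  refine ⟨c, h, ?_, hh, hah.symm⟩
  by_contra hc
  apply hfν
  rw [← hah]
  refine Ideal.add_mem _ ?_ (weightedMonomialIdeal_pair_le_pow hyxz hb ν hh)
  rw [pow_succ']
  have hy : y ∈ maximalIdeal S := hyxz ▸ Ideal.subset_span ⟨0, rfl⟩
  exact Ideal.mul_mem_mul ((mem_nonunits_iff.mpr hc : c ∈ nonunits S)) (Ideal.pow_mem_pow hy ν)

/-- **A tie at a fractional-slope curve centre forces `λ ∈ 𝔪`.**  `S` regular local of dimension `3` with regular system of parameters
`(y, x, z)`, `b ≥ 1`, `ν ≥ 1`, `f = c y^ν + h` with `c` a unit and `h ∈ 𝒥_{bν+1}((y,x);(b,1))`.  If `f ∈ 𝒥_{(b+1)ν}((x, y − λx^b, z); (1, b+1, 1))`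
then `λ ∈ 𝔪`.  (Else `(x, y', z)`, `y' = y − λx^b`, is a regular system of parameters and `c λ^ν x^{bν} = f − h − c(y^ν − λ^ν x^{bν})` lies in
`𝒥_{bν+1}((x, y', z); (1, b+1, 1))` — `y^ν − (λx^b)^ν` is `y'` times an element of `𝒥_{b(ν−1)}` — contradicting weighted quasi-regularity.)
[OURS · L1 W4.3 · CURVE-TIE.md §3 (b)] [cite: Matsumura1987, Thm. 16.2] -/
theorem mem_maximalIdeal_of_mem_tie_of_normalForm (hyxz : Ideal.span (Set.range ![y, x, z]) = maximalIdeal S)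
    (hd : ringKrullDim S = (3 : ℕ)) {b ν : ℕ} (hb : 1 ≤ b) (hν : 1 ≤ ν) {f c h : S} (hc : IsUnit c)
    (hh : h ∈ weightedMonomialIdeal ![y, x] ![b, 1] (b * ν + 1)) (hf : f = c * y ^ ν + h) {lam : S}
    (htie : f ∈ weightedMonomialIdeal ![x, y - lam * x ^ b, z] ![1, b + 1, 1] ((b + 1) * ν)) : lam ∈ maximalIdeal S := by
  by_contra hlam
  have hlamu : IsUnit lam := by
    by_contra h'; exact hlam (mem_nonunits_iff.mpr h')
  -- the regular system of parameters `(x, y', z)`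
  have hrsp : Ideal.span (Set.range ![x, y - lam * x ^ b, z]) = maximalIdeal S := by
    rw [LocalGameEFTCylinder.span_range_steepen _ _ _ _ (by omega), hyxz]
  have hw : ∀ i, 0 < (![1, b + 1, 1] : Fin 3 → ℕ) i := by
    intro i; fin_cases i <;> simp
  -- `c λ^ν x^{bν} ∈ 𝒥_{bν+1}((x, y', z); (1, b+1, 1))`
  set J := weightedMonomialIdeal ![x, y - lam * x ^ b, z] ![1, b + 1, 1] with hJ
  have hx1 : x ∈ J 1 := Ideal.subset_span ⟨![1, 0, 0], by simp [Fin.sum_univ_three], by simp [Fin.prod_univ_three]⟩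
  have hy'mem : y - lam * x ^ b ∈ J (b + 1) := Ideal.subset_span ⟨![0, 1, 0], by simp [Fin.sum_univ_three], by simp [Fin.prod_univ_three]⟩
  have hymem : y ∈ J b := weightedMonomialIdeal_pair_le_steep y x z lam b b (Ideal.subset_span ⟨![1, 0], by simp [Fin.sum_univ_two], by simp [Fin.prod_univ_two]⟩)
  have hxbmem : lam * x ^ b ∈ J b := by
    refine Ideal.mul_mem_left _ _ ?_
    have hpow := AQSHeightTwo.pow_mem_weightedMonomialIdeal_mul _ _ hx1 b
    rwa [one_mul] at hpow
  have hgeom : y ^ ν - (lam * x ^ b) ^ ν ∈ J (b * ν + 1) := by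
    rw [← Commute.geom_sum₂_mul (Commute.all y (lam * x ^ b))]
    have hsum : (∑ i ∈ Finset.range ν, y ^ i * (lam * x ^ b) ^ (ν - 1 - i)) ∈ J (b * (ν - 1)) := by
      refine Ideal.sum_mem _ fun i hi => ?_
      have hi' : i < ν := Finset.mem_range.mp hi
      have h1 := AQSHeightTwo.pow_mem_weightedMonomialIdeal_mul _ _ hymem i
      have h2 := AQSHeightTwo.pow_mem_weightedMonomialIdeal_mul _ _ hxbmem (ν - 1 - i)
      have h12 := weightedMonomialIdeal_mul_le _ _ _ _ (Ideal.mul_mem_mul h1 h2)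
      rw [show b * i + b * (ν - 1 - i) = b * (ν - 1) by rw [← Nat.mul_add]; congr 1; omega] at h12
      exact h12
    have hdiff : y - lam * x ^ b ∈ J (b + 1) := hy'mem
    have h := weightedMonomialIdeal_mul_le _ _ _ _ (Ideal.mul_mem_mul hsum hdiff)
    rw [show b * (ν - 1) + (b + 1) = b * ν + 1 by
      rw [Nat.mul_sub, Nat.mul_one]; have := Nat.mul_le_mul_left b hν; omega] at h
    exact h
  have hfJ : f ∈ J (b * ν + 1) := weightedMonomialIdeal_antitone _ _ (by nlinarith) htie
  have hhJ : h ∈ J (b * ν + 1) := weightedMonomialIdeal_pair_le_steep y x z lam b _ hh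
  have hkey : c * lam ^ ν * x ^ (b * ν) ∈ J (b * ν + 1) := by
    have heq : c * lam ^ ν * x ^ (b * ν) = f - h - c * (y ^ ν - (lam * x ^ b) ^ ν) := by
      rw [hf, mul_pow, ← pow_mul, mul_comm b ν]; ring
    rw [heq]
    exact Ideal.sub_mem _ (Ideal.sub_mem _ hfJ hhJ) (Ideal.mul_mem_left _ _ hgeom)
  -- quasi-regularity: the coefficient `c λ^ν` of the monomial `x^{bν}` (`= u₀^{bν}`, weight `bν`) lies in `𝔪`
  have hmon : c * lam ^ ν * (![x, y - lam * x ^ b, z] : Fin 3 → S) 0 ^ (b * ν) ∈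
      weightedMonomialIdeal ![x, y - lam * x ^ b, z] ![1, b + 1, 1] ((![1, b + 1, 1] : Fin 3 → ℕ) 0 * (b * ν) + 1) := by
    simpa [hJ] using hkey
  have hcl := mem_maximalIdeal_of_monomial_mem ![x, y - lam * x ^ b, z] hrsp hd ![1, b + 1, 1] hw 0 (b * ν) hmon
  exact (mem_maximalIdeal _).mp hcl (hc.mul (hlamu.pow ν))

/-- **The `X = 0` locus is empty at a fractional-slope curve centre** (`b = 1`): `f = c y^ν + h`, `c` a unit, `h ∈ 𝒥_{ν+1}((y,x);(1,1))`, `ν ≥ 1`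
⟹ `f ∉ 𝒥_{2ν}((y, x, z); (1, 2, 1))`.  (Both `𝒥_{2ν}((y,x,z);(1,2,1))` and `𝒥_{ν+1}((y,x);(1,1))` lie in `𝒥_{ν+1}((y,x,z);(1,2,2))`, where `c y^ν`
would be a unit monomial of weight `ν`.) [OURS · L1 W4.3 · CURVE-TIE.md §3] [cite: Matsumura1987, Thm. 16.2] -/
theorem not_mem_weightedMonomialIdeal_X_of_normalForm (hyxz : Ideal.span (Set.range ![y, x, z]) = maximalIdeal S)
    (hd : ringKrullDim S = (3 : ℕ)) {ν : ℕ} (hν : 1 ≤ ν) {f c h : S} (hc : IsUnit c)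
    (hh : h ∈ weightedMonomialIdeal ![y, x] ![1, 1] (1 * ν + 1)) (hf : f = c * y ^ ν + h) :
    f ∉ weightedMonomialIdeal ![y, x, z] ![1, 2, 1] (2 * ν) := by
  intro hmem
  have hw : ∀ i, 0 < (![1, 2, 2] : Fin 3 → ℕ) i := by
    intro i; fin_cases i <;> simp
  set J := weightedMonomialIdeal ![y, x, z] ![1, 2, 2] with hJ
  have hy : y ∈ J 1 := Ideal.subset_span ⟨![1, 0, 0], by simp [Fin.sum_univ_three], by simp [Fin.prod_univ_three]⟩
  have hx : x ∈ J 2 := Ideal.subset_span ⟨![0, 1, 0], by simp [Fin.sum_univ_three], by simp [Fin.prod_univ_three]⟩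
  have hz : z ∈ J 2 := Ideal.subset_span ⟨![0, 0, 1], by simp [Fin.sum_univ_three], by simp [Fin.prod_univ_three]⟩
  -- `𝒥_{2ν}((y,x,z);(1,2,1)) ≤ J (2ν) ≤ J (ν+1)`
  have h1 : weightedMonomialIdeal ![y, x, z] ![1, 2, 1] (2 * ν) ≤ J (ν + 1) := by
    refine (weightedMonomialIdeal_le_of_forall_mem_of_mul_le J (weightedMonomialIdeal_zero _ _) (weightedMonomialIdeal_mul_le _ _)
      (weightedMonomialIdeal_antitone _ _) ![y, x, z] ![1, 2, 1] (fun i => ?_) (2 * ν)).trans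
      (weightedMonomialIdeal_antitone _ _ (by omega))
    fin_cases i
    · exact hy
    · exact hx
    · exact weightedMonomialIdeal_antitone _ _ (by norm_num) hz
  -- `𝒥_{ν+1}((y,x);(1,1)) ≤ J (ν+1)`
  have h2 : weightedMonomialIdeal ![y, x] ![1, 1] (1 * ν + 1) ≤ J (ν + 1) := by
    rw [one_mul]
    refine weightedMonomialIdeal_le_of_forall_mem_of_mul_le J (weightedMonomialIdeal_zero _ _) (weightedMonomialIdeal_mul_le _ _)
      (weightedMonomialIdeal_antitone _ _) ![y, x] ![1, 1] (fun i => ?_) (ν + 1)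
    fin_cases i
    · exact hy
    · exact weightedMonomialIdeal_antitone _ _ (by norm_num) hx
  have hkey : c * y ^ ν ∈ J (ν + 1) := by
    have heq : c * y ^ ν = f - h := by rw [hf]; ring
    rw [heq]
    exact Ideal.sub_mem _ (h1 hmem) (h2 hh)
  have hmon : c * (![y, x, z] : Fin 3 → S) 0 ^ ν ∈
      weightedMonomialIdeal ![y, x, z] ![1, 2, 2] ((![1, 2, 2] : Fin 3 → ℕ) 0 * ν + 1) := by
    simpa [hJ] using hkey
  have hcl := mem_maximalIdeal_of_monomial_mem ![y, x, z] hyxz hd ![1, 2, 2] hw 0 ν hmon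
  exact (mem_maximalIdeal _).mp hcl hc

end NormalForm

end Iota3

end Summit.ResolutionOfSingularities.ResolutionOfSingularities.Cruxes.HypersurfaceCentreConstruction.LocalEngine

end
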